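import Literature.MathematicalPhysics.QuantumFieldTheory.Balaban1983to89.B8Eq1122Concrete

/-!
# `Balaban1983to89.B8Eq1122OnDomain` — T. Bałaban, *Spaces of regular gauge field configurations on a lattice and gauge fixing
# conditions*, Commun. Math. Phys. **99** (1985) 75–102 [Balaban1985RegularSpaces] ("B8"), Sect. E pp. 96–97: the argument
# (1.122)–(1.125) «`|C′(λ − H′X₁) − C′(λ − H′X₂)| ≦ C′₂2B′₀(α₃ + α₄)|X₁ − X₂|`» ABSTRACTED FROM ITS DOMAIN: for ANY function `C` on a
# complex vector space, ANY pair of admissibility predicates `D ⊇ D₂` («(1.120) ⊇ (1.119)») stable under the printed radius / segment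
# moves, analyticity of `C` along lines at the points of `D` and a bound `‖C‖ ≤ M` on `D` give the Cauchy estimate (1.124)–(1.125) and
# the Lipschitz bound of (1.122) on `D₂`

statement-level skeleton of published theorems with citation tags; proofs where landed; nothing here is a claim about the
Yang–Mills mass gap

PDF held: `paper:balaban1985-cmp99-regular-spaces-gauge-fixing` (journal page = PDF page + 74); pp. 96–97 [PDF 22–23] on the text layer
(this seat, 2026-08-25); the displays as quoted verbatim in `B8Eq1123Concrete` / `B8Ineq125Concrete` / `B8Eq1122Concrete` (unit
`lit-balaban-p05`), whose proofs for the concrete `C′_j(u₁, ·)` on the ONE-LEVEL (207)-domain are the model of this file.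

WHAT IS PRINTED (pp. 96–97): "Let us take `X₁, X₂` satisfying (1.119) and let us estimate the difference `C′(λ − H′X₁) − C′(λ − H′X₂) =
∫₀¹ dt (d/dt)C′(…) = −∫₀¹ dt ⟨(δ/δλ)C′(λ − tH′X₁ − (1 − t)H′X₂), H′X₁ − H′X₂⟩`, (1.122) where `⟨(δ/δλ)C′(λ), λ₀⟩ = (d/dτ)C′(λ + τλ₀)|_{τ=0}`
(1.123) … Using the analyticity properties of `C′(λ)`, the derivative above can be written as `… = (1/2πi)∫_{|τ|=r} dτ τ⁻² C′(λ + τλ₀)`.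
(1.124) Taking `r = (2max{|λ₀|, |Dλ₀|})⁻¹α₄`, we get the estimate `|⟨(δ/δλ)C′(λ), λ₀⟩| ≦ C′₂2max{|λ₀|, |Dλ₀|}(α₃ + α₄)`. (1.125) Applying it
to the expression (1.122) we have `|C′(λ − H′X₁) − C′(λ − H′X₂)| ≦ C′₂2B′₀(α₃ + α₄)|X₁ − X₂|`".  The STRUCTURE of the argument: two
nested admissible sets (1.119) ⊂ (1.120); the small set is convex and a disc of radius `r = α₄/(2m)` in a direction of modulus `m`
around any of its points stays in the large set; `C′` is analytic and bounded by `M = C′₂(α₃ + α₄)α₄` ((1.121)) on the large set;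
conclusion: derivative `≤ 2mM/α₄` (Cauchy) and Lipschitz constant `2mM/α₄` on the small set (FTC along the segment).

WHY THIS FILE.  The tree runs this argument for the concrete remainder on the one-level (207)-domain (`B8Ineq125Concrete`, `B8Eq1122Concrete`;
READING (b) there: «NOT CLAIMED: the region-dependent form on `{Ω_j}`»); B8's own sets (1.119)/(1.120) are REGION-DEPENDENT, and for the
inductive `u₁` the analyticity and the bound (1.121) are available only tower-locally (`B8Eq1124Local`, `B8Eq106Local.eq214_local_of_axial`).
Rather than re-running the 300-line argument per domain shape, THIS FILE proves it ONCE for arbitrary predicates `D`, `D₂` on an arbitrary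
complex vector space `V` and an arbitrary `C : V → F` (`F` complete normed), with exactly the four structural hypotheses print uses; the
region-dependent (and the one-level) statements are instances.

WHAT THIS FILE PROVES (kernel, 0 sorry, theorems only, no `def`).
* §1 `analyticAt_line_of_mem` — if `σ ↦ C(μ′ + σμ₀)` is analytic at `0` for every `μ′ ∈ D`, then `τ ↦ C(μ + τμ₀)` is analytic at every `τ`
  with `μ + τμ₀ ∈ D` (translation); `differentiableOn_line` — hence complex-differentiable on any closed disc mapped into `D`.
* §2 **`eq1124_onDomain`** — (1.124): `(d/dτ)C(μ + τμ₀)|₀ = (2πi)⁻¹∮_{|τ|=r} τ⁻²C(μ + τμ₀)dτ` when the closed `r`-disc maps into `D`;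
  **`ineq1125_onDomain`** — (1.125): if the closed disc of radius `α/(2m)` maps into `D` and `‖C‖ ≤ M` on `D`, then
  `‖(d/dτ)C(μ + τμ₀)|₀‖ ≤ 2mM/α` (`B8Ineq125.cauchy_weighted` BY NAME).
* §3 **`eq1122_onDomain`** — (1.122): `C(μ₁) − C(μ₂) = ∫₀¹ (d/dσ)C(p_t + σ(μ₁ − μ₂))|₀ dt`, `p_t = μ₂ + t(μ₁ − μ₂)`, when every `p_t` lies in
  `D₂` and `D₂`-points have their `α/(2m)`-discs (direction `μ₁ − μ₂`) in `D`; **`lipschitz1122_onDomain`** — «Applying it to the expression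
  (1.122)»: `‖C(μ₁) − C(μ₂)‖ ≤ 2mM/α`.
* §4 The printed radius / segment arithmetic, SITEWISE (so that any region shape instantiates §2–§3): `norm_line_lt` (`‖μ(x)‖ < α/2`,
  `‖μ₀(x)‖ ≤ m`, `|τ| ≤ α/(2m)` ⇒ `‖(μ + τμ₀)(x)‖ < α`), `norm_covLine_lt` (the same for the covariant differences `R(U₀(b))μ(b₊) − μ(b₋)` at
  scale `s`), `norm_segment_lt`, `norm_covSegment_lt` (convexity of the strict balls), for site functions `ℤᵈ → 𝔸` and `B7Eq170Flat.cj`.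

READINGS / DECLARED DEVIATIONS: (a) «analytic functions of `λ`» = analytic along complex lines (all that (1.122)–(1.125) use), as in
`B8Eq1123Concrete` READING (d); (b) `max{…} ≤ m`, `0 < m` instead of `= max{…}` (`B8Ineq125Concrete` READING (d)); (c) the sets enter only
through the two stability hypotheses — print's instance is `D = (1.120)`, `D₂ = (1.119)`, `M = C′₂(α₃ + α₄)α₄`, `α = α₄`, giving the displayed
`C′₂2m(α₃ + α₄)`.  NOT CLAIMED: any instance (they are the business of the concrete files), anything of Theorem 4.  Unit `pub-ymgap-dag-n04-b`
(YM Track A, node N05 [B8]), 2026-08-25.  Tree API by name only (`B8Ineq125.cauchy_weighted`, `B7Eq170Flat.cj`; Mathlib's Cauchy formula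
`DifferentiableOn.deriv_eq_smul_circleIntegral` and FTC `intervalIntegral.integral_eq_sub_of_hasDerivAt`), nothing restated; the proof steps
of `B8Ineq125Concrete`/`B8Eq1122Concrete` (unit p05) are reproduced in abstract form (credited).
-/

noncomputable section

open Metric Complex

namespace Literature.MathematicalPhysics.QuantumFieldTheory.Balaban1983to89.B8Eq1122OnDomain

variable {V : Type*} [AddCommGroup V] [Module ℂ V]
variable {F : Type*} [NormedAddCommGroup F] [NormedSpace ℂ F] [CompleteSpace F]

/-! ## §1 Analyticity along a line inside the admissible set -/

omit [CompleteSpace F] in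
/-- If `σ ↦ C(μ′ + σμ₀)` is analytic at `σ = 0` for every admissible `μ′ ∈ D`, then `τ ↦ C(μ + τμ₀)` is analytic at every `τ` whose point
`μ + τμ₀` is admissible (translate: `μ + σμ₀ = (μ + τμ₀) + (σ − τ)μ₀`). [cite: Balaban1985RegularSpaces, (1.124) p.97] -/
theorem analyticAt_line_of_mem {C : V → F} {D : V → Prop} {μ μ₀ : V}
    (hA : ∀ μ', D μ' → AnalyticAt ℂ (fun σ : ℂ => C (μ' + σ • μ₀)) 0) {τ : ℂ} (hτ : D (μ + τ • μ₀)) :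
    AnalyticAt ℂ (fun σ : ℂ => C (μ + σ • μ₀)) τ := by
  have h := hA _ hτ
  have heq : (fun σ : ℂ => C (μ + σ • μ₀)) = (fun σ : ℂ => C (μ + τ • μ₀ + σ • μ₀)) ∘ fun σ : ℂ => σ - τ := by
    funext σ
    simp only [Function.comp_apply, add_assoc, ← add_smul, add_sub_cancel]
  rw [heq]
  exact AnalyticAt.comp_of_eq h (analyticAt_id.sub analyticAt_const) (sub_self τ)

omit [CompleteSpace F] in
/-- … hence `τ ↦ C(μ + τμ₀)` is complex-differentiable on every closed disc `|τ| ≤ r` mapped into `D` (the `DiffContOnCl` input of the Cauchy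
estimate). [cite: Balaban1985RegularSpaces, (1.124) p.97] -/
theorem differentiableOn_line {C : V → F} {D : V → Prop} {μ μ₀ : V} {r : ℝ}
    (hline : ∀ τ : ℂ, ‖τ‖ ≤ r → D (μ + τ • μ₀))
    (hA : ∀ μ', D μ' → AnalyticAt ℂ (fun σ : ℂ => C (μ' + σ • μ₀)) 0) :
    DifferentiableOn ℂ (fun τ : ℂ => C (μ + τ • μ₀)) (closedBall (0 : ℂ) r) := by
  intro τ hτ
  rw [mem_closedBall, dist_zero_right] at hτ
  exact (analyticAt_line_of_mem hA (hline τ hτ)).differentiableAt.differentiableWithinAt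

/-! ## §2 (1.124) and (1.125) on an admissible set -/

/-- **(1.124) ON AN ADMISSIBLE SET**: if the closed disc `|τ| ≤ r` (`r > 0`) in the direction `μ₀` around `μ` is mapped into `D` and `C` is
analytic along the direction `μ₀` at every point of `D`, then `(d/dτ)C(μ + τμ₀)|_{τ=0} = (2πi)⁻¹∮_{|τ|=r} τ⁻² C(μ + τμ₀) dτ` (Mathlib's
Cauchy formula for the first derivative on the closed disc). [cite: Balaban1985RegularSpaces, (1.124) p.97] -/
theorem eq1124_onDomain {C : V → F} {D : V → Prop} {μ μ₀ : V} {r : ℝ} (hr : 0 < r)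
    (hline : ∀ τ : ℂ, ‖τ‖ ≤ r → D (μ + τ • μ₀))
    (hA : ∀ μ', D μ' → AnalyticAt ℂ (fun σ : ℂ => C (μ' + σ • μ₀)) 0) :
    deriv (fun τ : ℂ => C (μ + τ • μ₀)) 0 =
      (2 * Real.pi * Complex.I)⁻¹ • ∮ τ in C(0, r), (1 / τ ^ 2) • C (μ + τ • μ₀) := by
  have hd := differentiableOn_line hline hA
  have h := hd.deriv_eq_smul_circleIntegral hr
  simp only [sub_zero] at h
  rw [eq_comm, inv_smul_eq_iff₀ Complex.two_pi_I_ne_zero, ← h]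

omit [CompleteSpace F] in
/-- **(1.125) ON AN ADMISSIBLE SET** («Taking `r = (2max{|λ₀|, |Dλ₀|})⁻¹α₄`, we get the estimate `|⟨(δ/δλ)C′(λ), λ₀⟩| ≦ C′₂2max{…}(α₃ + α₄)`»):
if the closed disc of radius `α/(2m)` (`m, α > 0`) in the direction `μ₀` around `μ` is mapped into `D`, `C` is analytic along `μ₀` at the
points of `D` and `‖C‖ ≤ M` on `D`, then `‖(d/dτ)C(μ + τμ₀)|_{τ=0}‖ ≤ 2mM/α` (`B8Ineq125.cauchy_weighted`; print: `M = C′₂(α₃ + α₄)α₄`, `α = α₄`,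
`m = max{|λ₀|, |Dλ₀|}`, bound `C′₂2m(α₃ + α₄)`). [cite: Balaban1985RegularSpaces, (1.125) p.97, (1.121) p.96] -/
theorem ineq1125_onDomain {C : V → F} {D : V → Prop} {μ μ₀ : V} {m α M : ℝ} (hm : 0 < m) (hα : 0 < α)
    (hline : ∀ τ : ℂ, ‖τ‖ ≤ α / (2 * m) → D (μ + τ • μ₀))
    (hA : ∀ μ', D μ' → AnalyticAt ℂ (fun σ : ℂ => C (μ' + σ • μ₀)) 0)
    (hM : ∀ μ', D μ' → ‖C μ'‖ ≤ M) :
    ‖deriv (fun τ : ℂ => C (μ + τ • μ₀)) 0‖ ≤ 2 * m * M / α := by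
  have hd := differentiableOn_line hline hA
  have hdc : DiffContOnCl ℂ (fun τ : ℂ => C (μ + τ • μ₀)) (ball (0 : ℂ) (α / (2 * m))) := hd.diffContOnCl_ball (subset_refl _)
  refine B8Ineq125.cauchy_weighted hm hα hdc fun τ hτ => ?_
  rw [mem_sphere, dist_zero_right] at hτ
  exact hM _ (hline τ hτ.le)

/-! ## §3 (1.122) and the Lipschitz bound on the small admissible set -/

omit [CompleteSpace F] in
/-- A complex derivative at a real point is a real derivative of the restriction to the real axis (vector-valued form of Mathlib's
`HasDerivAt.comp_ofReal`). [folklore] -/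
private theorem hasDerivAt_comp_ofReal_vec {g : ℂ → F} {g' : F} {t : ℝ} (hg : HasDerivAt g g' (t : ℂ)) :
    HasDerivAt (fun s : ℝ => g (s : ℂ)) g' t := by
  have h := ((hg.hasFDerivAt.restrictScalars ℝ).comp t Complex.ofRealCLM.hasFDerivAt).hasDerivAt
  have h' : HasDerivAt (g ∘ Complex.ofReal) g' t := h.congr_deriv (by simp)
  exact h'

/-- **(1.122) ON AN ADMISSIBLE SET** («`C′(λ − H′X₁) − C′(λ − H′X₂) = ∫₀¹ dt (d/dt)C′(…)`»), for the two end-points `μ₁`, `μ₂`: if every point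
`p_t = μ₂ + t(μ₁ − μ₂)`, `0 ≤ t ≤ 1`, of the segment lies in `D₂`, every point of `D₂` is in `D` together with a disc `|τ| ≤ r` (`r ≥ 0`) in the
direction `μ₁ − μ₂`, and `C` is analytic along `μ₁ − μ₂` at the points of `D`, then
`C(μ₁) − C(μ₂) = ∫₀¹ (d/dσ)C(p_t + σ(μ₁ − μ₂))|_{σ=0} dt` (FTC for the real restriction of the analytic curve through the segment).
[cite: Balaban1985RegularSpaces, (1.122)–(1.123) p.96] -/
theorem eq1122_onDomain {C : V → F} {D D₂ : V → Prop} {μ₁ μ₂ : V} {r : ℝ} (hr : 0 ≤ r)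
    (hseg : ∀ t : ℝ, 0 ≤ t → t ≤ 1 → D₂ (μ₂ + (t : ℂ) • (μ₁ - μ₂)))
    (hline : ∀ μ, D₂ μ → ∀ τ : ℂ, ‖τ‖ ≤ r → D (μ + τ • (μ₁ - μ₂)))
    (hA : ∀ μ', D μ' → AnalyticAt ℂ (fun σ : ℂ => C (μ' + σ • (μ₁ - μ₂))) 0) :
    C μ₁ - C μ₂ = ∫ t in (0 : ℝ)..1, deriv (fun σ : ℂ => C (μ₂ + (t : ℂ) • (μ₁ - μ₂) + σ • (μ₁ - μ₂))) 0 := by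
  -- the complex curve through the segment
  set g : ℂ → F := fun τ => C (μ₂ + τ • (μ₁ - μ₂)) with hgdef
  -- analyticity of `g` at the real points of `[0, 1]`
  have hga : ∀ t : ℝ, t ∈ Set.Icc (0 : ℝ) 1 → AnalyticAt ℂ g (t : ℂ) := by
    intro t ht
    have hD : D (μ₂ + (t : ℂ) • (μ₁ - μ₂)) := by
      simpa only [zero_smul, add_zero] using hline _ (hseg t ht.1 ht.2) 0 (by rw [norm_zero]; exact hr)
    exact analyticAt_line_of_mem hA hD
  -- the integrand is the derivative of `g` along the segment (translation)
  have hder : ∀ t : ℝ, deriv (fun σ : ℂ => C (μ₂ + (t : ℂ) • (μ₁ - μ₂) + σ • (μ₁ - μ₂))) 0 = deriv g (t : ℂ) := by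
    intro t
    have h : (fun σ : ℂ => C (μ₂ + (t : ℂ) • (μ₁ - μ₂) + σ • (μ₁ - μ₂))) = fun σ : ℂ => g ((t : ℂ) + σ) := by
      funext σ; simp only [hgdef, add_smul, add_assoc]
    rw [h, deriv_comp_const_add, add_zero]
  have hreal : ∀ t ∈ Set.uIcc (0 : ℝ) 1, HasDerivAt (fun s : ℝ => g (s : ℂ)) (deriv g (t : ℂ)) t := by
    intro t ht
    rw [Set.uIcc_of_le zero_le_one] at ht
    exact hasDerivAt_comp_ofReal_vec (hga t ht).differentiableAt.hasDerivAt
  have hcont : ContinuousOn (fun t : ℝ => deriv g (t : ℂ)) (Set.uIcc (0 : ℝ) 1) := by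
    intro t ht
    rw [Set.uIcc_of_le zero_le_one] at ht
    exact (((hga t ht).deriv.continuousAt).comp Complex.continuous_ofReal.continuousAt).continuousWithinAt
  have hftc := intervalIntegral.integral_eq_sub_of_hasDerivAt hreal hcont.intervalIntegrable
  have hg1 : g ((1 : ℝ) : ℂ) = C μ₁ := by simp [hgdef]
  have hg0 : g ((0 : ℝ) : ℂ) = C μ₂ := by simp [hgdef]
  simp_rw [hder]
  rw [hftc, hg1, hg0]

/-- **«APPLYING IT TO THE EXPRESSION (1.122) WE HAVE `|C′(λ − H′X₁) − C′(λ − H′X₂)| ≦ C′₂2B′₀(α₃ + α₄)|X₁ − X₂|`» ON AN ADMISSIBLE SET**: if the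
segment from `μ₂` to `μ₁` lies in `D₂`, every `D₂`-point carries its closed disc of radius `α/(2m)` (`m, α > 0`) in the direction `μ₁ − μ₂`
inside `D`, `C` is analytic along `μ₁ − μ₂` at the points of `D` and `‖C‖ ≤ M` on `D`, then `‖C(μ₁) − C(μ₂)‖ ≤ 2mM/α` ((1.122), then (1.125) at
every point of the segment, `‖∫₀¹‖ ≤ sup`; print: `m = max{|H′(X₁ − X₂)|, |DH′(X₁ − X₂)|} ≤ B′₀|X₁ − X₂|`, `M = C′₂(α₃ + α₄)α₄`, `α = α₄`).
[cite: Balaban1985RegularSpaces, (1.122)–(1.125) pp.96–97] -/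
theorem lipschitz1122_onDomain {C : V → F} {D D₂ : V → Prop} {μ₁ μ₂ : V} {m α M : ℝ} (hm : 0 < m) (hα : 0 < α)
    (hseg : ∀ t : ℝ, 0 ≤ t → t ≤ 1 → D₂ (μ₂ + (t : ℂ) • (μ₁ - μ₂)))
    (hline : ∀ μ, D₂ μ → ∀ τ : ℂ, ‖τ‖ ≤ α / (2 * m) → D (μ + τ • (μ₁ - μ₂)))
    (hA : ∀ μ', D μ' → AnalyticAt ℂ (fun σ : ℂ => C (μ' + σ • (μ₁ - μ₂))) 0)
    (hM : ∀ μ', D μ' → ‖C μ'‖ ≤ M) :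
    ‖C μ₁ - C μ₂‖ ≤ 2 * m * M / α := by
  have hr : 0 ≤ α / (2 * m) := by positivity
  rw [eq1122_onDomain hr hseg hline hA]
  have hbound : ∀ t ∈ Set.uIoc (0 : ℝ) 1,
      ‖deriv (fun σ : ℂ => C (μ₂ + (t : ℂ) • (μ₁ - μ₂) + σ • (μ₁ - μ₂))) 0‖ ≤ 2 * m * M / α := by
    intro t ht
    rw [Set.uIoc_of_le zero_le_one] at ht
    exact ineq1125_onDomain hm hα (hline _ (hseg t ht.1.le ht.2)) hA hM
  have h := intervalIntegral.norm_integral_le_of_norm_le_const hbound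
  rwa [sub_zero, abs_one, mul_one] at h

/-! ## §4 The printed radius and segment arithmetic, sitewise -/

section Sitewise

variable {d : ℕ}
variable {𝔸 : Type*} [NormedRing 𝔸] [NormedAlgebra ℂ 𝔸]

open B7Eq170Flat (cj cj_apply cj_add cj_neg)

/-- A site value along the line: `‖μ(x)‖ < α/2`, `‖μ₀(x)‖ ≤ m` (`m > 0`), `|τ| ≤ α/(2m)` ⇒ `‖(μ + τμ₀)(x)‖ < α` («Taking `r = (2max{…})⁻¹α₄`»,
(1.119) ⇒ (1.120) along the circle). [cite: Balaban1985RegularSpaces, (1.124)–(1.125) p.97, (1.119)–(1.120) p.96] -/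
theorem norm_line_lt {μ μ₀ : B7Prop1Explicit.Site d → 𝔸} {x : B7Prop1Explicit.Site d} {α m : ℝ} (hμ : ‖μ x‖ < α / 2)
    (hμ₀ : ‖μ₀ x‖ ≤ m) (hm : 0 < m) {τ : ℂ} (hτ : ‖τ‖ ≤ α / (2 * m)) : ‖(μ + τ • μ₀) x‖ < α := by
  have hτm : ‖τ‖ * m ≤ α / 2 := by
    calc ‖τ‖ * m ≤ α / (2 * m) * m := mul_le_mul_of_nonneg_right hτ hm.le
      _ = α / 2 := by field_simp
  calc ‖(μ + τ • μ₀) x‖ = ‖μ x + τ • μ₀ x‖ := rfl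
    _ ≤ ‖μ x‖ + ‖τ • μ₀ x‖ := norm_add_le _ _
    _ = ‖μ x‖ + ‖τ‖ * ‖μ₀ x‖ := by rw [norm_smul]
    _ ≤ ‖μ x‖ + ‖τ‖ * m := by gcongr
    _ < α / 2 + α / 2 := add_lt_add_of_lt_of_le hμ hτm
    _ = α := by ring

/-- The covariant difference is `ℂ`-linear along the line: `R(w)((μ + τμ₀)(y)) − (μ + τμ₀)(x) = (R(w)μ(y) − μ(x)) + τ(R(w)μ₀(y) − μ₀(x))`.
[cite: Balaban1985RegularSpaces, (1.123) p.96] (elementary API; as `B8Eq1123Concrete.cjDiff_line`) -/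
theorem cjDiff_line (w : 𝔸ˣ) (μ μ₀ : B7Prop1Explicit.Site d → 𝔸) (τ : ℂ) (x y : B7Prop1Explicit.Site d) :
    cj w ((μ + τ • μ₀) y) - (μ + τ • μ₀) x = (cj w (μ y) - μ x) + τ • (cj w (μ₀ y) - μ₀ x) := by
  simp only [Pi.add_apply, Pi.smul_apply, cj_add, B8Eq1123Concrete.cj_smul_complex, smul_sub]
  abel

/-- A covariant bond difference along the line, at scale `s ≥ 0`: `‖R(w)μ(y) − μ(x)‖ < (α/2)s`, `‖R(w)μ₀(y) − μ₀(x)‖ ≤ ms`, `|τ| ≤ α/(2m)` ⇒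
`‖R(w)(μ + τμ₀)(y) − (μ + τμ₀)(x)‖ < αs` (print's `s = (Lʲη)⁻¹` on `Ω_j` — any region, any scale). [cite: Balaban1985RegularSpaces, (1.124)–(1.125) p.97, (1.119)–(1.120) p.96] -/
theorem norm_covLine_lt (w : 𝔸ˣ) {μ μ₀ : B7Prop1Explicit.Site d → 𝔸} {x y : B7Prop1Explicit.Site d} {α m s : ℝ}
    (hμ : ‖cj w (μ y) - μ x‖ < α / 2 * s) (hμ₀ : ‖cj w (μ₀ y) - μ₀ x‖ ≤ m * s) (hm : 0 < m) (hs : 0 ≤ s)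
    {τ : ℂ} (hτ : ‖τ‖ ≤ α / (2 * m)) : ‖cj w ((μ + τ • μ₀) y) - (μ + τ • μ₀) x‖ < α * s := by
  have hτm : ‖τ‖ * m ≤ α / 2 := by
    calc ‖τ‖ * m ≤ α / (2 * m) * m := mul_le_mul_of_nonneg_right hτ hm.le
      _ = α / 2 := by field_simp
  rw [cjDiff_line]
  calc ‖(cj w (μ y) - μ x) + τ • (cj w (μ₀ y) - μ₀ x)‖
      ≤ ‖cj w (μ y) - μ x‖ + ‖τ • (cj w (μ₀ y) - μ₀ x)‖ := norm_add_le _ _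
    _ = ‖cj w (μ y) - μ x‖ + ‖τ‖ * ‖cj w (μ₀ y) - μ₀ x‖ := by rw [norm_smul]
    _ ≤ ‖cj w (μ y) - μ x‖ + ‖τ‖ * (m * s) := by gcongr
    _ = ‖cj w (μ y) - μ x‖ + ‖τ‖ * m * s := by ring
    _ ≤ ‖cj w (μ y) - μ x‖ + α / 2 * s := by gcongr
    _ < α / 2 * s + α / 2 * s := by linarith
    _ = α * s := by ring

/-- Convexity of a strict ball along a real segment: `‖A₁‖, ‖A₂‖ < c`, `0 ≤ t ≤ 1` ⇒ `‖A₂ + t(A₁ − A₂)‖ < c`. [folklore] -/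
private theorem norm_add_real_smul_sub_lt {A₁ A₂ : 𝔸} {c t : ℝ} (h1 : ‖A₁‖ < c) (h2 : ‖A₂‖ < c) (ht0 : 0 ≤ t) (ht1 : t ≤ 1) :
    ‖A₂ + (t : ℂ) • (A₁ - A₂)‖ < c := by
  have heq : A₂ + (t : ℂ) • (A₁ - A₂) = (t : ℝ) • A₁ + (1 - t : ℝ) • A₂ := by
    rw [Complex.coe_smul, smul_sub, sub_smul, one_smul]; abel
  rw [heq]
  rcases eq_or_lt_of_le ht1 with rfl | ht1'
  · simpa using h1
  · calc ‖(t : ℝ) • A₁ + (1 - t : ℝ) • A₂‖ ≤ ‖(t : ℝ) • A₁‖ + ‖(1 - t : ℝ) • A₂‖ := norm_add_le _ _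
      _ = t * ‖A₁‖ + (1 - t) * ‖A₂‖ := by
          rw [norm_smul, norm_smul, Real.norm_eq_abs, Real.norm_eq_abs, abs_of_nonneg ht0, abs_of_nonneg (by linarith)]
      _ < t * c + (1 - t) * c := by
          have h3 : t * ‖A₁‖ ≤ t * c := mul_le_mul_of_nonneg_left h1.le ht0
          have h4 : (1 - t) * ‖A₂‖ < (1 - t) * c := mul_lt_mul_of_pos_left h2 (by linarith)
          linarith
      _ = c := by ring

/-- A site value along the segment: `‖μ₁(x)‖, ‖μ₂(x)‖ < a`, `0 ≤ t ≤ 1` ⇒ `‖(μ₂ + t(μ₁ − μ₂))(x)‖ < a` («The sets (1.119)/(1.120) are convex» —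
print integrates along the segment). [cite: Balaban1985RegularSpaces, (1.122) p.96] -/
theorem norm_segment_lt {μ₁ μ₂ : B7Prop1Explicit.Site d → 𝔸} {x : B7Prop1Explicit.Site d} {a t : ℝ} (h1 : ‖μ₁ x‖ < a)
    (h2 : ‖μ₂ x‖ < a) (ht0 : 0 ≤ t) (ht1 : t ≤ 1) : ‖(μ₂ + (t : ℂ) • (μ₁ - μ₂)) x‖ < a :=
  norm_add_real_smul_sub_lt h1 h2 ht0 ht1

/-- A covariant bond difference along the segment: `‖R(w)μᵢ(y) − μᵢ(x)‖ < c` (`i = 1, 2`), `0 ≤ t ≤ 1` ⇒ the same for `μ₂ + t(μ₁ − μ₂)`.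
[cite: Balaban1985RegularSpaces, (1.122) p.96] -/
theorem norm_covSegment_lt (w : 𝔸ˣ) {μ₁ μ₂ : B7Prop1Explicit.Site d → 𝔸} {x y : B7Prop1Explicit.Site d} {c t : ℝ}
    (h1 : ‖cj w (μ₁ y) - μ₁ x‖ < c) (h2 : ‖cj w (μ₂ y) - μ₂ x‖ < c) (ht0 : 0 ≤ t) (ht1 : t ≤ 1) :
    ‖cj w ((μ₂ + (t : ℂ) • (μ₁ - μ₂)) y) - (μ₂ + (t : ℂ) • (μ₁ - μ₂)) x‖ < c := by
  rw [cjDiff_line, B8Eq1122Concrete.cjDiff_sub]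
  exact norm_add_real_smul_sub_lt h1 h2 ht0 ht1

end Sitewise

end Literature.MathematicalPhysics.QuantumFieldTheory.Balaban1983to89.B8Eq1122OnDomain

end
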